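import Summits.HodgeConjecture.HodgeConjecture.Theorems.MarkmanPartnerTransportRMSpreadDefs
import Literature.AlgebraicGeometry.Surfaces.K3ComplexMultiplication
import Literature.AlgebraicGeometry.Surfaces.K3Marking

/-!
# Route MarkmanPartnerTransport · cruxes `PicardThreeK3Squares` (stmt-HodgeConjecture-19652) and
# `LowPicardRealMultiplication` (stmt-HodgeConjecture-19653) — shared definitions of the line
# «RM-TYPE DESCENT OF THE MODULI INPUT» (planner p1 g36, memo ROUTE-P1AI §A; Sketch
# `HOME/p1/route/Sketch_RMTypeDescent_g36.lean`, sha16 808160432320109f, farm rc 0)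

Cell hodge-nonav. The crux idea «maximal-family spread» reduced the real-multiplication third for ONE
surface `S` with generator `t` to the input `RMSpreadFamily S hS t`
(`Theorems/MarkmanPartnerTransportRMSpreadDefs`, non-vacuous and lossless: p611064). The planner's
structural point (memo ROUTE-P1AI §A): that input need only be DISPLAYED for ONE marked model per
RATIONAL real-multiplication type, because the tree moves marked projective K3 surfaces along rational
isometries `σ ∈ O(Λ_ℚ)` without changing the truth value of HC⁴ of the square
(`IsogenyInvariance.exists_isogenous_markedK3`). The two definitions below are VERBATIM the Sketch's:

* `thetaC θ` — the complexification `θ_ℂ ∈ End(Λ_ℂ)` of a rational model endomorphism `θ ∈ M₂₂(ℚ)`;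
* `RMTypeDominated θ` — **(D), the displayed moduli input, one per rational RM type**: for `θ`
  SELF-ADJOINT for `k3Form`, every marked projective K3 surface `(S', η', p', y)` (the `MarkedK3` binder
  of the route, expanded verbatim) whose period `y` is a `θ_ℂ`-eigenvector and is `θ`-GENERIC (every
  rational vector orthogonal to `y` — every rational Néron–Severi vector in the marking — is killed by
  `θ`) carries an `RMSpreadFamily` for the transported endomorphism `η'⁻¹ ∘ θ_ℂ ∘ η'`.

Intended discharge (NOT in the tree — moduli carriers do not exist): the universal family over a level
cover of the RM component `B_θ ⊂ M_d^lev` through a maximal van Geemen–Schütt family with model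
endomorphism `θ` (Huybrechts, *Lectures on K3 Surfaces*, Ch. 6 §4.2: `M_d^lev := Γ_ℓ∖N_d` smooth
quasi-projective WITH universal family, period map an open embedding; Baily–Borel Thm. 6.1.13;
Cattani–Deligne–Kaplan for the algebraicity of the RM locus), its flat generator section, and the
classifying morphism of that family (dominance = the (I2) input, `l - 2` effective moduli: van
Geemen–Schütt 2025 Thm. 1.1 (9), (11), Thm. 1.2 (2)). Consumers: `hodgeConjectureFor_square_of_rmTypeDominated`
(W3-T, prover 20241-p1) and `rmTypeDominated_of_isDominatedByCycles` (W3 «COMPONENT ⇒ DOMINATED»,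
prover 19652-p1). With the self-adjointness antecedent the Prop is implied by the Hodge conjecture for
K3 squares (the transported endomorphism is a rational HODGE endomorphism at every `θ`-eigen period)
and cannot be refuted short of refuting it; `θ = 0` is a provable, harmless instance (referee A46-3).

Two definitions, nothing asserted, no instance, no notation beyond a local one, no sorry. Landed by
prover seat hodge-nonav-19652-p1 (gen 8) for the cell (assignment p1 g36 08:53:04Z: shared file,
`--supports stmt-HodgeConjecture-19652`).

References: van Geemen–Schütt, Forum Math. Sigma 13 (2025) e2, §3.4, Thm. 1.1 (9), (11), Thm. 1.2 (2),
§4.8; Huybrechts, *Lectures on K3 Surfaces*, Ch. 6 §4.2, Thm. 6.1.13; Cattani–Deligne–Kaplan, JAMS 8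
(1995), Cor. 1.2; Buskin, J. reine angew. Math. 755 (2019), Thm. 1.1.
-/

set_option linter.dupNamespace false

noncomputable section

namespace Summit.HodgeConjecture.HodgeConjecture.Theorems.MarkmanPartnerTransport

open CategoryTheory MonoidalCategory
open Literature.AlgebraicGeometry Literature.AlgebraicGeometry.Motives Literature.AlgebraicGeometry.HodgeTheory
open Literature.AlgebraicGeometry.Surfaces
open Literature.AlgebraicTopology.SingularHomology

/-- `MarkedK3[S, η, p, x]`: VERBATIM the `let MarkedK3 := …` binder of the route declaration
`PicardThreeK3Squares` (as in `…IsogenousRepresentative`). Local notation only. -/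
local notation3 (prettyPrint := false) "MarkedK3[" S ", " η ", " p ", " x "]" =>
  (p ≠ 0 ∧ (IsIntegralClass p ∧
    (∀ q : complexBetti S (2 * 2), IsIntegralClass q → ∃ n : ℤ, q = n • p) ∧
    (∀ c : complexBetti S (2 * 1), IsIntegralClass c ↔ ∃ v : K3Index → ℤ, η c = fun i => (v i : ℂ)) ∧
    (∀ a b : complexBetti S (2 * 1),
      cupProduct (rfl : 2 * 1 + 2 * 1 = 2 * 2) a b = k3Form (η a) (η b) • p) ∧
    IsOfHodgeType 2 S (2 * 1) 2 0 (LinearEquiv.symm η x) ∧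
    (∀ τ : complexBetti S (2 * 1), IsOfHodgeType 2 S (2 * 1) 2 0 τ →
      ∃ t : ℂ, τ = t • LinearEquiv.symm η x)) ∧
    (k3Form x x = 0 ∧ 0 < (k3Form (star x) x).re ∧
      ∃ u : K3Index → ℤ, k3Form (fun i => (u i : ℂ)) x = 0 ∧ 0 < ∑ i, ∑ j, u i * k3Gram i j * u j))

/-- **The complexification `θ_ℂ ∈ End(Λ_ℂ)` of a rational model endomorphism `θ ∈ M₂₂(ℚ)`** (the
model endomorphism of a rational real-multiplication type, e.g. `ζ₁₁ + ζ₁₁⁻¹` on `U² ⊕ E₈² ⊗ ℚ` read off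
the van Geemen–Schütt family of Thm. 1.1 (11)). [cite: GeemenSchutt2023, §2.1 and Thm. 1.1 (11)] -/
def thetaC (θ : Matrix K3Index K3Index ℚ) : Module.End ℂ (K3Index → ℂ) :=
  Matrix.toLin' (θ.map (algebraMap ℚ ℂ))

/-- **(D) the displayed moduli input, one per RATIONAL real-multiplication type** (planner p1 g36,
memo ROUTE-P1AI §A; VERBATIM the Sketch's `RMTypeDominated`). For `θ` SELF-ADJOINT with respect to
`k3Form` (so that the transported endomorphism is a rational HODGE endomorphism at every `θ`-eigen
period), every marked projective K3 surface `(S', η', p', y)` whose period `y` is a `θ_ℂ`-eigenvector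
and is `θ`-generic (every rational vector orthogonal to `y`, i.e. every rational Néron–Severi vector in
the marking, is killed by `θ`) admits an `RMSpreadFamily` for the transported endomorphism
`t' = η'⁻¹ ∘ θ_ℂ ∘ η'`. Intended discharge (NOT in the tree; moduli carriers do not exist): the universal
family over a level cover of the RM component `B_θ ⊂ M_d^lev` through the maximal van Geemen–Schütt
family with model endomorphism `θ`, its flat generator section, and the classifying morphism of that
family (dominant = the (I2) input; `l - 2` effective moduli). Not claimed to hold for any `θ ≠ 0`.
[cite: GeemenSchutt2023, §3.4, Thm. 1.1 (9), (11), Thm. 1.2 (2) and §4.8]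
[cite: Huybrechts2016K3, Ch. 6 §4.2 and Thm. 6.1.13] [cite: CattaniDeligneKaplan1995JAMS, Cor. 1.2] -/
def RMTypeDominated (θ : Matrix K3Index K3Index ℚ) : Prop :=
  ∀ (S' : SchemeOver ℂ) (hS' : IsK3Surface S') (η' : complexBetti S' (2 * 1) ≃ₗ[ℂ] (K3Index → ℂ))
    (p' : complexBetti S' (2 * 2)) (y : K3Index → ℂ) (e : ℂ),
    (∀ a b : K3Index → ℂ, k3Form (thetaC θ a) b = k3Form a (thetaC θ b)) →
    MarkedK3[S', η', p', y] → thetaC θ y = e • y →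
    (∀ v : K3Index → ℚ, k3Form (fun i => (v i : ℂ)) y = 0 → θ.mulVec v = 0) →
    Nonempty (RMSpreadFamily S' hS'.isSmoothProjective
      (η'.symm.toLinearMap ∘ₗ (thetaC θ ∘ₗ η'.toLinearMap)))

end Summit.HodgeConjecture.HodgeConjecture.Theorems.MarkmanPartnerTransport

end
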